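import Literature.Topology.FourManifolds.FoxMilnorChart
import Literature.Topology.FourManifolds.FlatteningChart
import Literature.Topology.FourManifolds.KnotsMirrorProofs
import Literature.Topology.FourManifolds.CircleDiffeotopy
import Literature.Topology.FourManifolds.BandSumUnitProfiles
import HarnessLib

/-!
# Fox–Milnor symmetric model, II: the radial band of a flat model

Topic `Literature/Topology/FourManifolds`; fact seat
`provefact-Literature.Topology.FourManifolds.Knot.isSmoothlySlice_of_isConnectedSum_mirror_reverse`
(`BandSum.lean`: Fox–Milnor, `K # (-K̄)` is smoothly slice). Sequel of `FoxMilnorChart.lean`: for a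
flat model `Φ` (a knot `A = Φ.A` in the northern hemisphere whose chart image contains the
horizontal segment `{q + s e}` at the bottom height `-1`), this file builds **the band of the
symmetric connected sum `A # (-Ā)`** and verifies the band-only clauses of `BandData`
(`BandSum.lean`) for the summands `A` and `B = A.mirror.reverse = R ∘ A ∘ r` (`R = reflectLast 3`
the reflection in the equator, `r = reflectLast 1`). In the chart `ψ` the band is *radial*:

> `bandChart (x₀, x₁) = e^{2 x₀ L(x₁)} (q + S(x₁) e)`, `band = ψ⁻¹ ∘ bandChart`,

where `S x₁ = σ (θaff x₁)` reads the segment through the affine parameter map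
`θaff x₁ = θ₁ + κ (x₁ - 1/2)` of slope `κ ≤ 1` (`FlatModel.κ`), and `L x₁ = log (2 / ‖q + S e‖)`:
the left edge line `x₀ = 0` is the segment of `A` (`band_pt2_zero`), the middle line `x₀ = 1/2`
lies on the sphere of radius `2` = the equator (`band_mem_sphereEquator_iff`), the right edge
line is the inverted segment = the segment of `B` (`band_pt2_one`), and the inversion = the
reflection `R` flips the square, `band (1 - x₀, x₁) = R (band (x₀, x₁))` (`band_sflip`).
Everything here is proved:

* window bookkeeping (`wid`, `κ`, `θaff_mem`: the collar `x₁ ∈ (-1, 2)` is read inside the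
  parameter window), `S`, `segPt`, `L`, `μb`, `bandChart` with smoothness, the radius formula
  `‖bandChart x‖ = 2 e^{(2x₀-1) L(x₁)}` and the hemisphere/equator criteria, injectivity on the
  collar strip (`bandChart_injOn`), the derivative `DbandChart` (`hasFDerivAt_bandChart`) and its
  injectivity (`injective_DbandChart`: a radial and an `e`-component);
* `band`: smooth into `𝕊³` (`contMDiff_band`), injective and immersive on the collar strip
  (`band_injOn`, `injective_mfderiv_band`, through `KnotsInBall.phi` and
  `injective_mfderiv_of_injective_fderiv_coe`), `band_sflip`, `band_apply_last_pos_iff` /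
  `_neg_iff`, `band_mem_sphereEquator_iff`, the edge lines `band_pt2_zero`, `band_pt2_one`;
* **the band meets `A` exactly in its left edge line** (`band_mem_range_A_iff`, for collar widths
  `δ ≤ ν/2`, `δ ≤ 1`: outside the segment the band lies strictly below the bottom height of `A` or
  in the slab met by `A` only along the segment) and `B` exactly in its right edge line
  (`band_mem_range_B_iff`, by the symmetry);
* the velocities along the edge lines (`fderiv_coe_band_pt2_zero/one`) and **the orientation
  clauses** `orient_left_band` (at `θ₁`, factor `1/κ`) and `orient_right_band` (at `-θ₁`) of
  `BandData` for the summands `A`, `B`; the reversed mirror image along the angle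
  (`mirror_reverse_apply_circlePoint`, `curve_mirror_reverse`, `range_mirror_reverse`).

## References

* R. H. Fox, J. W. Milnor, *Singularities of 2-spheres in 4-space and cobordism of knots*, Osaka
  J. Math. 3 (1966), 257–267, §1. [FoxMilnor1966]
* C. Livingston, *A survey of classical knot concordance* (2005), §2.1. [Livingston2005]
* R. E. Gompf, A. I. Stipsicz, *4-Manifolds and Kirby Calculus* (1999), §5.1 (band sums).
  [GompfStipsicz1999]

## Design notes

No statement of another file is modified; no named fact is introduced (D-0026); no `sorry`.
`SphereEmbedding.curve` (the `2π`-periodic curve of `DehnSurgeryTubularNbhdProofs.lean`) is always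
written in full, since dot notation on a `Knot` resolves to the `1`-periodic `Knot.curve` of
`KnotFraming.lean`. `BandSumUnit.pt2_eta` and `hasDerivAt_pt2`, `smoothStep` come from
`BandSumUnitProfiles.lean` / `PlanarArch.lean`. `𝔼 n`, `𝕊 n` are local notation as in `Knots.lean`.
-/

open scoped Manifold ContDiff Topology Real RealInnerProductSpace
open Function Set Metric

noncomputable section

namespace Literature.Topology.FourManifolds

/-- Local notation: `𝔼 n` is the model Euclidean space `EuclideanSpace ℝ (Fin n)`. -/
local notation "𝔼 " n:arg => EuclideanSpace ℝ (Fin n)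

/-- Local notation: `𝕊 n` is the unit sphere in `EuclideanSpace ℝ (Fin (n + 1))`. -/
local notation "𝕊 " n:arg => (Metric.sphere (0 : EuclideanSpace ℝ (Fin (n + 1))) 1)

attribute [local instance] fact_finrank_euclideanSpace_succ

namespace FoxMilnorModel

open KnotsInBall Knot.SymmetricUnion

/-! ## Planar preliminaries -/

/-- The symmetry `(x₀, x₁) ↦ (1 - x₀, x₁)` of the band square about its middle line `x₀ = 1/2`
(it corresponds to the reflection `R` of `𝕊³` under the radial band, `band_sflip`). [folklore] -/
def sflip (x : 𝔼 2) : 𝔼 2 := pt2 (1 - x 0) (x 1)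

/-- First coordinate of `sflip x`. [folklore] -/
@[simp] theorem sflip_apply_zero (x : 𝔼 2) : sflip x 0 = 1 - x 0 := rfl

/-- Second coordinate of `sflip x`. [folklore] -/
@[simp] theorem sflip_apply_one (x : 𝔼 2) : sflip x 1 = x 1 := rfl

/-- `sflip` is an involution. [folklore] -/
@[simp] theorem sflip_sflip (x : 𝔼 2) : sflip (sflip x) = x := by
  ext i; fin_cases i <;> simp [sflip, pt2_apply_zero, pt2_apply_one]

/-- `sflip` on points in coordinates. [folklore] -/
@[simp] theorem sflip_pt2 (a b : ℝ) : sflip (pt2 a b) = pt2 (1 - a) b := rfl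

/-- `sflip` preserves the square neighbourhoods. [folklore] -/
theorem sflip_mem_squareNhd {δ : ℝ} {x : 𝔼 2} (hx : x ∈ squareNhd δ) : sflip x ∈ squareNhd δ := by
  rw [mem_squareNhd_iff] at hx ⊢
  intro i
  fin_cases i
  · have h := hx 0
    simp only [Fin.zero_eta, sflip_apply_zero, mem_Ioo] at h ⊢
    constructor <;> linarith [h.1, h.2]
  · simpa using hx 1

namespace FlatModel

variable (Φ : FlatModel)

/-! ## The parameter window read by the band -/

/-- The usable half-width of the parameter window around `θ₁`. [folklore] -/
def wid : ℝ := min (Φ.β - Φ.θ₁) (Φ.θ₁ - Φ.α)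

/-- The half-width is positive. [folklore] -/
theorem wid_pos : 0 < Φ.wid := lt_min (by linarith [Φ.lt_β]) (by linarith [Φ.α_lt])

/-- The slope of the affine parameter map of the band (`≤ 1`, and small enough that the band
collar `(-1, 2)` is read inside the window). [folklore] -/
def κ : ℝ := min 1 (Φ.wid / 2)

/-- The slope is positive. [folklore] -/
theorem κ_pos : 0 < Φ.κ := lt_min one_pos (by linarith [Φ.wid_pos])

/-- The slope is at most `1`. [folklore] -/
theorem κ_le_one : Φ.κ ≤ 1 := min_le_left _ _

/-- The slope is at most half the half-width. [folklore] -/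
theorem κ_le_wid : Φ.κ ≤ Φ.wid / 2 := min_le_right _ _

/-- The affine parameter map `x₁ ↦ θ₁ + κ (x₁ - 1/2)` of the band: the left edge point at height
`x₁` is `A (θaff x₁)`. [folklore] -/
def θaff (x₁ : ℝ) : ℝ := Φ.θ₁ + Φ.κ * (x₁ - 2⁻¹)

/-- `θaff (1/2) = θ₁`. [folklore] -/
@[simp] theorem θaff_half : Φ.θaff 2⁻¹ = Φ.θ₁ := by simp [θaff]

/-- The band collar `(-1, 2)` is read strictly inside the window. [folklore] -/
theorem θaff_mem {x₁ : ℝ} (hx : x₁ ∈ Ioo (-1 : ℝ) 2) : Φ.θaff x₁ ∈ Ioo Φ.α Φ.β := by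
  have hκ := Φ.κ_pos
  have hκw := Φ.κ_le_wid
  have hw₁ : Φ.wid ≤ Φ.β - Φ.θ₁ := min_le_left _ _
  have hw₂ : Φ.wid ≤ Φ.θ₁ - Φ.α := min_le_right _ _
  simp only [θaff, mem_Ioo] at hx ⊢
  constructor <;> nlinarith [hx.1, hx.2]

/-- Closed form of `θaff_mem`. [folklore] -/
theorem θaff_mem_Icc {x₁ : ℝ} (hx : x₁ ∈ Ioo (-1 : ℝ) 2) : Φ.θaff x₁ ∈ Icc Φ.α Φ.β :=
  Ioo_subset_Icc_self (Φ.θaff_mem hx)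

/-- `θaff` is affine with slope `κ`. [folklore] -/
theorem hasDerivAt_θaff (x₁ : ℝ) : HasDerivAt Φ.θaff Φ.κ x₁ := by
  unfold θaff
  simpa using ((hasDerivAt_id x₁).sub_const (2⁻¹ : ℝ)).const_mul Φ.κ |>.const_add Φ.θ₁

/-- `θaff` is smooth. [folklore] -/
theorem contDiff_θaff : ContDiff ℝ ∞ Φ.θaff := by
  unfold θaff; fun_prop

/-- `θaff` is strictly increasing. [folklore] -/
theorem strictMono_θaff : StrictMono Φ.θaff := fun _ _ hab ↦ by
  unfold θaff; nlinarith [Φ.κ_pos]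

/-! ## The segment coordinate `S` and the segment point -/

/-- The segment coordinate `S x₁ = σ (θaff x₁)` of the left edge point at height `x₁`. [folklore] -/
def S (x₁ : ℝ) : ℝ := Φ.σ (Φ.θaff x₁)

/-- `S (1/2) = 0`. [folklore] -/
@[simp] theorem S_half : Φ.S 2⁻¹ = 0 := by simp [S, Φ.σ_θ₁]

/-- `S` is smooth. [folklore] -/
theorem contDiff_S : ContDiff ℝ ∞ Φ.S := Φ.contDiff_σ.comp Φ.contDiff_θaff

/-- `σ` is differentiable. [folklore] -/
theorem differentiable_σ : Differentiable ℝ Φ.σ := Φ.contDiff_σ.differentiable (by simp)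

/-- The derivative of `S`. [folklore] -/
theorem hasDerivAt_S (x₁ : ℝ) : HasDerivAt Φ.S (deriv Φ.σ (Φ.θaff x₁) * Φ.κ) x₁ :=
  (Φ.differentiable_σ _).hasDerivAt.comp x₁ (Φ.hasDerivAt_θaff x₁)

/-- The derivative of `S`, abbreviated. [folklore] -/
def dS (x₁ : ℝ) : ℝ := deriv Φ.σ (Φ.θaff x₁) * Φ.κ

/-- `S' = dS`. [folklore] -/
theorem hasDerivAt_S' (x₁ : ℝ) : HasDerivAt Φ.S (Φ.dS x₁) x₁ := Φ.hasDerivAt_S x₁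

/-- `deriv S = dS`. [folklore] -/
theorem deriv_S (x₁ : ℝ) : deriv Φ.S x₁ = Φ.dS x₁ := (Φ.hasDerivAt_S' x₁).deriv

/-- `S' > 0` on the collar. [folklore] -/
theorem dS_pos {x₁ : ℝ} (hx : x₁ ∈ Ioo (-1 : ℝ) 2) : 0 < Φ.dS x₁ :=
  mul_pos (Φ.deriv_σ_pos _ (Φ.θaff_mem_Icc hx)) Φ.κ_pos

/-- `σ` is strictly increasing on the window. [folklore] -/
theorem strictMonoOn_σ : StrictMonoOn Φ.σ (Icc Φ.α Φ.β) :=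
  strictMonoOn_of_deriv_pos (convex_Icc _ _) Φ.contDiff_σ.continuous.continuousOn fun θ hθ ↦
    Φ.deriv_σ_pos θ (interior_subset hθ)

/-- `S` is strictly increasing on the collar. [folklore] -/
theorem strictMonoOn_S : StrictMonoOn Φ.S (Ioo (-1 : ℝ) 2) := fun _ ha _ hb hab ↦
  Φ.strictMonoOn_σ (Φ.θaff_mem_Icc ha) (Φ.θaff_mem_Icc hb) (Φ.strictMono_θaff hab)

/-- `|S| < ℓ` on the collar. [folklore] -/
theorem abs_S_lt {x₁ : ℝ} (hx : x₁ ∈ Ioo (-1 : ℝ) 2) : |Φ.S x₁| < Φ.ℓ := by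
  have hm := Φ.θaff_mem hx
  have h1 : Φ.σ Φ.α < Φ.S x₁ :=
    Φ.strictMonoOn_σ (left_mem_Icc.2 (by linarith [Φ.α_lt, Φ.lt_β])) (Φ.θaff_mem_Icc hx) hm.1
  have h2 : Φ.S x₁ < Φ.σ Φ.β :=
    Φ.strictMonoOn_σ (Φ.θaff_mem_Icc hx) (right_mem_Icc.2 (by linarith [Φ.α_lt, Φ.lt_β])) hm.2
  rw [Φ.σ_α] at h1
  rw [Φ.σ_β] at h2
  exact abs_lt.2 ⟨h1, h2⟩

/-- `|S| < 1/2` on the collar. [folklore] -/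
theorem abs_S_lt_half {x₁ : ℝ} (hx : x₁ ∈ Ioo (-1 : ℝ) 2) : |Φ.S x₁| < 2⁻¹ :=
  (Φ.abs_S_lt hx).trans_le Φ.ℓ_le

/-- `qbase ⊥ e` (the segment direction is horizontal). [folklore] -/
theorem inner_qbase_e : ⟪qbase, Φ.e⟫ = 0 := by
  rw [qbase, inner_neg_left, EuclideanSpace.inner_single_left, Φ.e_two]
  simp

/-- The chart point `q + S x₁ e` of the segment at height `x₁`. [folklore] -/
def segPt (x₁ : ℝ) : 𝔼 3 := qbase + Φ.S x₁ • Φ.e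

/-- The segment point lies at height `-1`. [folklore] -/
@[simp] theorem segPt_apply_two (x₁ : ℝ) : Φ.segPt x₁ 2 = -1 := by
  simp [segPt, Φ.e_two]

/-- The `e`-coordinate of the segment point is `S`. [folklore] -/
@[simp] theorem inner_segPt_e (x₁ : ℝ) : ⟪Φ.segPt x₁, Φ.e⟫ = Φ.S x₁ := by
  rw [segPt, inner_add_left, Φ.inner_qbase_e, real_inner_smul_left,
    real_inner_self_eq_norm_sq, Φ.norm_e]
  ring

/-- `‖q + S e‖² = 1 + S²`. [folklore] -/
theorem norm_segPt_sq (x₁ : ℝ) : ‖Φ.segPt x₁‖ ^ 2 = 1 + Φ.S x₁ ^ 2 := by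
  have h : ⟪qbase, Φ.S x₁ • Φ.e⟫ = 0 := by rw [real_inner_smul_right, Φ.inner_qbase_e, mul_zero]
  have h2 := norm_add_sq_eq_norm_sq_add_norm_sq_of_inner_eq_zero _ _ h
  rw [norm_smul, norm_qbase, Φ.norm_e, Real.norm_eq_abs] at h2
  simp only [mul_one] at h2
  rw [segPt, sq, h2, ← sq, sq_abs]

/-- `‖q + S e‖ = √(1 + S²)`. [folklore] -/
theorem norm_segPt (x₁ : ℝ) : ‖Φ.segPt x₁‖ = √(1 + Φ.S x₁ ^ 2) := by
  rw [← Φ.norm_segPt_sq, Real.sqrt_sq (norm_nonneg _)]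

/-- `1 ≤ ‖q + S e‖`. [folklore] -/
theorem one_le_norm_segPt (x₁ : ℝ) : 1 ≤ ‖Φ.segPt x₁‖ := by
  have h := Φ.norm_segPt_sq x₁
  nlinarith [sq_nonneg (Φ.S x₁), norm_nonneg (Φ.segPt x₁)]

/-- The segment point is nonzero. [folklore] -/
theorem segPt_ne_zero (x₁ : ℝ) : Φ.segPt x₁ ≠ 0 := by
  rw [← norm_ne_zero_iff]; linarith [Φ.one_le_norm_segPt x₁]

/-- On the collar, `‖q + S e‖² < 5/4 < 4`. [folklore] -/
theorem norm_segPt_sq_lt {x₁ : ℝ} (hx : x₁ ∈ Ioo (-1 : ℝ) 2) : ‖Φ.segPt x₁‖ ^ 2 < 5 / 4 := by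
  rw [Φ.norm_segPt_sq]
  have h := Φ.abs_S_lt_half hx
  have : Φ.S x₁ ^ 2 < 4⁻¹ := by
    rw [← sq_abs]; nlinarith [abs_nonneg (Φ.S x₁)]
  linarith

/-- On the collar, `‖q + S e‖ < 2` (the segment lies in the northern hemisphere). [folklore] -/
theorem norm_segPt_lt_two {x₁ : ℝ} (hx : x₁ ∈ Ioo (-1 : ℝ) 2) : ‖Φ.segPt x₁‖ < 2 := by
  nlinarith [Φ.norm_segPt_sq_lt hx, norm_nonneg (Φ.segPt x₁)]

/-- `segPt` is smooth. [folklore] -/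
theorem contDiff_segPt : ContDiff ℝ ∞ Φ.segPt :=
  contDiff_const.add (Φ.contDiff_S.smul contDiff_const)

/-- The derivative of `segPt` is `S' e`. [folklore] -/
theorem hasDerivAt_segPt (x₁ : ℝ) : HasDerivAt Φ.segPt (Φ.dS x₁ • Φ.e) x₁ := by
  unfold segPt
  exact ((Φ.hasDerivAt_S' x₁).smul_const Φ.e).const_add qbase

/-! ## The logarithmic radius `L` and the radial factor -/

/-- The logarithmic radius `L x₁ = log (2 / ‖q + S x₁ e‖) = log 2 - log (1 + S²)/2` of the
left edge point at height `x₁`: the equator is at chart radius `2 = e^{L} ‖q + S e‖`. [folklore] -/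
def L (x₁ : ℝ) : ℝ := Real.log 2 - Real.log (1 + Φ.S x₁ ^ 2) / 2

/-- `1 + S² > 0`. [folklore] -/
theorem one_add_S_sq_pos (x₁ : ℝ) : 0 < 1 + Φ.S x₁ ^ 2 := by positivity

/-- `e^{L} = 2 / ‖q + S e‖`. [folklore] -/
theorem exp_L (x₁ : ℝ) : Real.exp (Φ.L x₁) = 2 / ‖Φ.segPt x₁‖ := by
  rw [L, Φ.norm_segPt, Real.exp_sub, Real.exp_log two_pos]
  congr 1
  rw [Real.sqrt_eq_rpow, Real.rpow_def_of_pos (Φ.one_add_S_sq_pos x₁)]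
  congr 1
  ring

/-- `L > 0` on the collar. [folklore] -/
theorem L_pos {x₁ : ℝ} (hx : x₁ ∈ Ioo (-1 : ℝ) 2) : 0 < Φ.L x₁ := by
  have h1 : Φ.S x₁ ^ 2 < 4⁻¹ := by
    have h := Φ.abs_S_lt_half hx
    rw [← sq_abs]; nlinarith [abs_nonneg (Φ.S x₁)]
  have h2 : Real.log (1 + Φ.S x₁ ^ 2) < Real.log 2 :=
    Real.log_lt_log (Φ.one_add_S_sq_pos x₁) (by linarith)
  have h3 : 0 ≤ Real.log (1 + Φ.S x₁ ^ 2) := Real.log_nonneg (by nlinarith [sq_nonneg (Φ.S x₁)])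
  unfold L; linarith

/-- `L ≤ log 2`. [folklore] -/
theorem L_le (x₁ : ℝ) : Φ.L x₁ ≤ Real.log 2 := by
  have h3 : 0 ≤ Real.log (1 + Φ.S x₁ ^ 2) := Real.log_nonneg (by nlinarith [sq_nonneg (Φ.S x₁)])
  unfold L; linarith

/-- `L < 1`. [folklore] -/
theorem L_lt_one (x₁ : ℝ) : Φ.L x₁ < 1 :=
  (Φ.L_le x₁).trans_lt (by
    have := Real.log_two_lt_d9; norm_num at this; linarith)

/-- `L` is smooth. [folklore] -/
theorem contDiff_L : ContDiff ℝ ∞ Φ.L := by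
  unfold L
  exact contDiff_const.sub (((contDiff_const.add (Φ.contDiff_S.pow 2)).log
    (fun x ↦ (Φ.one_add_S_sq_pos x).ne')).div_const 2)

/-- The derivative of `L`, abbreviated. [folklore] -/
def dL (x₁ : ℝ) : ℝ := -(Φ.S x₁ * Φ.dS x₁) / (1 + Φ.S x₁ ^ 2)

/-- The derivative of `L`. [folklore] -/
theorem hasDerivAt_L (x₁ : ℝ) : HasDerivAt Φ.L (Φ.dL x₁) x₁ := by
  have h1 : HasDerivAt (fun x ↦ 1 + Φ.S x ^ 2) (2 * Φ.S x₁ * Φ.dS x₁) x₁ := by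
    have := ((Φ.hasDerivAt_S' x₁).pow 2).const_add 1
    simpa [mul_comm, mul_assoc, mul_left_comm] using this
  have h3 := ((h1.log (Φ.one_add_S_sq_pos x₁).ne').div_const 2).const_sub (Real.log 2)
  have h4 : -(2 * Φ.S x₁ * Φ.dS x₁ / (1 + Φ.S x₁ ^ 2) / 2) = Φ.dL x₁ := by
    unfold dL
    field_simp
  rw [h4] at h3
  exact h3

/-- The radial factor `e^{2 x₀ L(x₁)} = (2 / ‖q + S e‖)^{2 x₀}` of the band. [folklore] -/
def μb (x : 𝔼 2) : ℝ := Real.exp (2 * x 0 * Φ.L (x 1))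

/-- The radial factor is positive. [folklore] -/
theorem μb_pos (x : 𝔼 2) : 0 < Φ.μb x := Real.exp_pos _

/-- The radial factor on the left edge is `1`. [folklore] -/
@[simp] theorem μb_pt2_zero (x₁ : ℝ) : Φ.μb (pt2 0 x₁) = 1 := by
  simp [μb]

/-- The radial factor is smooth. [folklore] -/
theorem contDiff_μb : ContDiff ℝ ∞ Φ.μb := by
  unfold μb
  refine (ContDiff.mul (contDiff_const.mul (contDiff_apply_zero)) ?_).exp
  exact Φ.contDiff_L.comp contDiff_apply_one

/-- The radial factor under the symmetry of the square: `μ (1 - x₀, x₁) = e^{2L} / μ (x₀, x₁)`.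
[folklore] -/
theorem μb_sflip (x : 𝔼 2) : Φ.μb (sflip x) = Real.exp (2 * Φ.L (x 1)) * (Φ.μb x)⁻¹ := by
  rw [μb, μb, sflip_apply_zero, sflip_apply_one, ← Real.exp_neg, ← Real.exp_add]
  congr 1; ring

/-! ## The band in the chart -/

/-- **The radial band in the chart**: `x ↦ e^{2 x₀ L(x₁)} (q + S x₁ e)`, the segment
`{q + s e}` (left edge `x₀ = 0`) pushed radially outwards through the sphere of radius `2`
(middle line `x₀ = 1/2`) to its inversion (right edge `x₀ = 1`). [folklore] -/
def bandChart (x : 𝔼 2) : 𝔼 3 := Φ.μb x • Φ.segPt (x 1)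

/-- The band chart is smooth. [folklore] -/
theorem contDiff_bandChart : ContDiff ℝ ∞ Φ.bandChart :=
  Φ.contDiff_μb.smul (Φ.contDiff_segPt.comp contDiff_apply_one)

/-- The height of the band chart point is `-μ`. [folklore] -/
@[simp] theorem bandChart_apply_two (x : 𝔼 2) : Φ.bandChart x 2 = -Φ.μb x := by
  simp [bandChart]

/-- The `e`-coordinate of the band chart point is `μ S`. [folklore] -/
@[simp] theorem inner_bandChart_e (x : 𝔼 2) : ⟪Φ.bandChart x, Φ.e⟫ = Φ.μb x * Φ.S (x 1) := by
  rw [bandChart, real_inner_smul_left, inner_segPt_e]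

/-- The band chart on the left edge is the segment. [folklore] -/
@[simp] theorem bandChart_pt2_zero (x₁ : ℝ) : Φ.bandChart (pt2 0 x₁) = Φ.segPt x₁ := by
  simp [bandChart]

/-- The band chart point is nonzero. [folklore] -/
theorem bandChart_ne_zero (x : 𝔼 2) : Φ.bandChart x ≠ 0 :=
  smul_ne_zero (Φ.μb_pos x).ne' (Φ.segPt_ne_zero _)

/-- **The chart radius of the band**: `‖band x‖ = 2 e^{(2 x₀ - 1) L(x₁)}`. [folklore] -/
theorem norm_bandChart (x : 𝔼 2) : ‖Φ.bandChart x‖ = 2 * Real.exp ((2 * x 0 - 1) * Φ.L (x 1)) := by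
  rw [bandChart, norm_smul, Real.norm_eq_abs, abs_of_pos (Φ.μb_pos x), μb]
  have h := Φ.exp_L (x 1)
  have hn : 0 < ‖Φ.segPt (x 1)‖ := by linarith [Φ.one_le_norm_segPt (x 1)]
  have h' : ‖Φ.segPt (x 1)‖ = 2 * Real.exp (-Φ.L (x 1)) := by
    rw [Real.exp_neg, h]; field_simp
  rw [h', show (2 * x 0 - 1) * Φ.L (x 1) = 2 * x 0 * Φ.L (x 1) + -Φ.L (x 1) by ring, Real.exp_add]
  ring

/-- The band chart point has radius `< 2` (northern hemisphere) iff `x₀ < 1/2`, on the collar.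
[folklore] -/
theorem norm_bandChart_lt_two_iff {x : 𝔼 2} (hx : x 1 ∈ Ioo (-1 : ℝ) 2) :
    ‖Φ.bandChart x‖ < 2 ↔ x 0 < 2⁻¹ := by
  rw [Φ.norm_bandChart x]
  have hL := Φ.L_pos hx
  constructor
  · intro h
    have h1 : Real.exp ((2 * x 0 - 1) * Φ.L (x 1)) < 1 := by linarith
    rw [Real.exp_lt_one_iff] at h1
    nlinarith
  · intro h
    have h1 : (2 * x 0 - 1) * Φ.L (x 1) < 0 := by nlinarith
    have := Real.exp_lt_one_iff.2 h1
    linarith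

/-- The band chart point has radius `> 2` (southern hemisphere) iff `1/2 < x₀`, on the collar.
[folklore] -/
theorem two_lt_norm_bandChart_iff {x : 𝔼 2} (hx : x 1 ∈ Ioo (-1 : ℝ) 2) :
    2 < ‖Φ.bandChart x‖ ↔ 2⁻¹ < x 0 := by
  rw [Φ.norm_bandChart x]
  have hL := Φ.L_pos hx
  constructor
  · intro h
    have h1 : 1 < Real.exp ((2 * x 0 - 1) * Φ.L (x 1)) := by linarith
    rw [Real.one_lt_exp_iff] at h1
    nlinarith
  · intro h
    have h1 : 0 < (2 * x 0 - 1) * Φ.L (x 1) := by nlinarith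
    have := Real.one_lt_exp_iff.2 h1
    linarith

/-- The band chart point has radius `2` (equator) iff `x₀ = 1/2`, on the collar. [folklore] -/
theorem norm_bandChart_eq_two_iff {x : 𝔼 2} (hx : x 1 ∈ Ioo (-1 : ℝ) 2) :
    ‖Φ.bandChart x‖ = 2 ↔ x 0 = 2⁻¹ := by
  rcases lt_trichotomy (x 0) 2⁻¹ with h | h | h
  · have := (Φ.norm_bandChart_lt_two_iff hx).2 h
    exact ⟨fun h' ↦ absurd h' this.ne, fun h' ↦ absurd h' h.ne⟩
  · refine ⟨fun _ ↦ h, fun _ ↦ ?_⟩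
    rw [Φ.norm_bandChart x, h]; simp
  · have := (Φ.two_lt_norm_bandChart_iff hx).2 h
    exact ⟨fun h' ↦ absurd h' this.ne', fun h' ↦ absurd h' h.ne'⟩

/-- **The symmetry of the band chart**: the inversion in the sphere of radius `2` flips the
square, `ι (band x) = band (1 - x₀, x₁)`. [folklore] -/
theorem inv3_bandChart (x : 𝔼 2) : inv3 (Φ.bandChart x) = Φ.bandChart (sflip x) := by
  rw [bandChart, bandChart, inv3_smul (Φ.μb_pos x), inv3_apply, Φ.μb_sflip, sflip_apply_one,
    smul_smul]
  congr 1
  have hn : 0 < ‖Φ.segPt (x 1)‖ := by linarith [Φ.one_le_norm_segPt (x 1)]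
  have h : Real.exp (2 * Φ.L (x 1)) = (2 / ‖Φ.segPt (x 1)‖) ^ 2 := by
    rw [← Φ.exp_L, ← Real.exp_nat_mul]; ring_nf
  rw [h, div_pow]
  ring

/-- The band chart is injective on the collar strip `{x₁ ∈ (-1, 2)}`. [folklore] -/
theorem bandChart_injOn : InjOn Φ.bandChart {x | x 1 ∈ Ioo (-1 : ℝ) 2} := by
  intro x hx x' hx' h
  have h2 : Φ.μb x = Φ.μb x' := by
    have := congrArg (fun y : 𝔼 3 ↦ y 2) h
    simpa using this
  have hS : Φ.S (x 1) = Φ.S (x' 1) := by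
    have := congrArg (fun y : 𝔼 3 ↦ ⟪y, Φ.e⟫) h
    simp only [inner_bandChart_e, h2] at this
    exact mul_left_cancel₀ (Φ.μb_pos x').ne' this
  have h1 : x 1 = x' 1 := Φ.strictMonoOn_S.injOn hx hx' hS
  have h0 : x 0 = x' 0 := by
    rw [μb, μb, h1] at h2
    have := Real.exp_injective h2
    have hL := Φ.L_pos hx'
    nlinarith
  rw [← BandSumUnit.pt2_eta x, ← BandSumUnit.pt2_eta x', h0, h1]

/-! ## The derivative of the band chart -/

omit Φ in
/-- Chain rule for a function of the second coordinate (companion of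
`Knot.SymmetricUnion.hasFDerivAt_comp_apply_zero`). [folklore] -/
theorem hasFDerivAt_comp_apply_one {F : Type*} [NormedAddCommGroup F] [NormedSpace ℝ F]
    {G : ℝ → F} {G' : F} {p : 𝔼 2} (hG : HasDerivAt G G' (p 1)) :
    HasFDerivAt (fun q : 𝔼 2 ↦ G (q 1)) (π1.smulRight G') p := by
  have h := hG.hasFDerivAt.comp p (hasFDerivAt_apply_one p)
  refine h.congr_fderiv ?_
  ext w
  simp [ContinuousLinearMap.smulRight_apply]

/-- The exponent `2 x₀ L(x₁)` of the radial factor. [folklore] -/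
def expo (x : 𝔼 2) : ℝ := 2 * x 0 * Φ.L (x 1)

/-- The derivative of the exponent. [folklore] -/
def Dexpo (x : 𝔼 2) : 𝔼 2 →L[ℝ] ℝ :=
  (2 * x 0) • π1.smulRight (Φ.dL (x 1)) + Φ.L (x 1) • ((2 : ℝ) • π0)

/-- The derivative of the exponent, applied. [folklore] -/
theorem Dexpo_apply (x v : 𝔼 2) :
    Φ.Dexpo x v = 2 * Φ.L (x 1) * v 0 + 2 * x 0 * Φ.dL (x 1) * v 1 := by
  simp [Dexpo]
  ring

/-- The exponent has the stated derivative. [folklore] -/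
theorem hasFDerivAt_expo (x : 𝔼 2) : HasFDerivAt Φ.expo (Φ.Dexpo x) x := by
  have h0 : HasFDerivAt (fun y : 𝔼 2 ↦ 2 * y 0) ((2 : ℝ) • π0) x :=
    (hasFDerivAt_apply_zero x).const_mul 2
  have h1 : HasFDerivAt (fun y : 𝔼 2 ↦ Φ.L (y 1)) (π1.smulRight (Φ.dL (x 1))) x :=
    hasFDerivAt_comp_apply_one (Φ.hasDerivAt_L (x 1))
  exact h0.mul h1

/-- The radial factor has derivative `μ • Dexpo`. [folklore] -/
theorem hasFDerivAt_μb (x : 𝔼 2) : HasFDerivAt Φ.μb (Φ.μb x • Φ.Dexpo x) x :=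
  (Φ.hasFDerivAt_expo x).exp

/-- The derivative of the band chart. [folklore] -/
def DbandChart (x : 𝔼 2) : 𝔼 2 →L[ℝ] 𝔼 3 :=
  Φ.μb x • π1.smulRight (Φ.dS (x 1) • Φ.e) + (Φ.μb x • Φ.Dexpo x).smulRight (Φ.segPt (x 1))

/-- **The band chart has the stated derivative.** [folklore] -/
theorem hasFDerivAt_bandChart (x : 𝔼 2) : HasFDerivAt Φ.bandChart (Φ.DbandChart x) x := by
  have h1 : HasFDerivAt (fun y : 𝔼 2 ↦ Φ.segPt (y 1)) (π1.smulRight (Φ.dS (x 1) • Φ.e)) x :=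
    hasFDerivAt_comp_apply_one (Φ.hasDerivAt_segPt (x 1))
  exact (Φ.hasFDerivAt_μb x).smul h1

/-- `fderiv bandChart = DbandChart`. [folklore] -/
theorem fderiv_bandChart (x : 𝔼 2) : fderiv ℝ Φ.bandChart x = Φ.DbandChart x :=
  (Φ.hasFDerivAt_bandChart x).fderiv

/-- The derivative of the band chart, applied: a radial component and an `e`-component.
[folklore] -/
theorem DbandChart_apply (x v : 𝔼 2) : Φ.DbandChart x v =
    (Φ.μb x * (2 * Φ.L (x 1) * v 0 + 2 * x 0 * Φ.dL (x 1) * v 1)) • Φ.segPt (x 1) +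
      (Φ.μb x * (Φ.dS (x 1) * v 1)) • Φ.e := by
  simp only [DbandChart, _root_.add_apply, FunLike.coe_smul,
    Pi.smul_apply, ContinuousLinearMap.smulRight_apply, Dexpo_apply, smul_smul]
  rw [add_comm]
  congr 1
  simp [mul_comm]

/-- **The band chart is an immersion on the collar strip.** [folklore] -/
theorem injective_DbandChart {x : 𝔼 2} (hx : x 1 ∈ Ioo (-1 : ℝ) 2) : Injective (Φ.DbandChart x) := by
  refine (injective_iff_map_eq_zero (Φ.DbandChart x)).2 fun v hv ↦ ?_
  rw [DbandChart_apply] at hv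
  have hμ := Φ.μb_pos x
  have hdS := Φ.dS_pos hx
  have hL := Φ.L_pos hx
  -- height coordinate: the radial coefficient vanishes
  have h2 := congrArg (fun y : 𝔼 3 ↦ y 2) hv
  simp only [PiLp.add_apply, PiLp.smul_apply, smul_eq_mul, segPt_apply_two, Φ.e_two, mul_zero,
    add_zero, PiLp.zero_apply, mul_neg, mul_one, neg_eq_zero] at h2
  -- `e`-coordinate: the `e`-coefficient vanishes
  have he := congrArg (fun y : 𝔼 3 ↦ ⟪y, Φ.e⟫) hv
  simp only [inner_add_left, real_inner_smul_left, inner_segPt_e, real_inner_self_eq_norm_sq,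
    Φ.norm_e, one_pow, mul_one, inner_zero_left, h2, zero_mul, zero_add] at he
  have hv1 : v 1 = 0 := by
    rcases mul_eq_zero.1 he with h | h
    · exact absurd h hμ.ne'
    · rcases mul_eq_zero.1 h with h' | h'
      · exact absurd h' hdS.ne'
      · exact h'
  have hv0 : v 0 = 0 := by
    rw [hv1, mul_zero, add_zero] at h2
    rcases mul_eq_zero.1 h2 with h | h
    · exact absurd h hμ.ne'
    · rcases mul_eq_zero.1 h with h' | h'
      · nlinarith
      · exact h'
  rw [← BandSumUnit.pt2_eta v, hv0, hv1]
  ext i; fin_cases i <;> rfl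

/-! ## The band on the sphere -/

/-- **The radial band** `β = ψ⁻¹ ∘ bandChart : ℝ² → 𝕊³` of the flat model: its left edge line
`x₀ = 0` runs along the flat segment of `A`, its middle line `x₀ = 1/2` lies on the equator, its
right edge line `x₀ = 1` runs along the segment of `R ∘ A`, and `R` flips it (`band_sflip`).
[folklore] -/
def band (x : 𝔼 2) : 𝕊 3 := psi.symm (Φ.bandChart x)

/-- The band read in `ℝ⁴` is `φ ∘ bandChart`. [folklore] -/
theorem coe_band (x : 𝔼 2) : ((Φ.band x : 𝕊 3) : 𝔼 4) = phi (Φ.bandChart x) := rfl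

/-- The band is smooth. [folklore] -/
theorem contMDiff_band : ContMDiff 𝓘(ℝ, 𝔼 2) (𝓡 3) ∞ Φ.band :=
  contMDiff_psi_symm.comp Φ.contDiff_bandChart.contMDiff

/-- The band read in `ℝ⁴` is smooth. [folklore] -/
theorem contDiff_coe_band : ContDiff ℝ ∞ fun x ↦ ((Φ.band x : 𝕊 3) : 𝔼 4) :=
  contDiff_phi.comp Φ.contDiff_bandChart

/-- The chart image of the band is the band chart. [folklore] -/
@[simp] theorem psi_band (x : 𝔼 2) : psi (Φ.band x) = Φ.bandChart x := psi_apply_psi_symm _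

/-- The band misses the south pole. [folklore] -/
theorem band_ne_southPole (x : 𝔼 2) : Φ.band x ≠ southPole := psi_symm_ne_southPole _

/-- The band is injective on the collar strip. [folklore] -/
theorem band_injOn : InjOn Φ.band {x | x 1 ∈ Ioo (-1 : ℝ) 2} := fun x hx x' hx' h ↦
  Φ.bandChart_injOn hx hx' (by simpa using congrArg psi h)

/-- **The reflection flips the band**: `band (1 - x₀, x₁) = R (band x)`. [folklore] -/
theorem band_sflip (x : 𝔼 2) : Φ.band (sflip x) = reflectLast 3 (Φ.band x) := by
  rw [band, ← inv3_bandChart, psi_symm_inv3 (Φ.bandChart_ne_zero x)]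
  rfl

/-- The flipped band read in `ℝ⁴`. [folklore] -/
theorem coe_band_sflip (x : 𝔼 2) : ((Φ.band (sflip x) : 𝕊 3) : 𝔼 4) = refl4 (Φ.band x) := by
  rw [band_sflip, coe_reflectLast_three_eq]

/-- The derivative of the band read in `ℝ⁴`. [folklore] -/
theorem fderiv_coe_band (x : 𝔼 2) :
    fderiv ℝ (fun y ↦ ((Φ.band y : 𝕊 3) : 𝔼 4)) x = (fderiv ℝ phi (Φ.bandChart x)).comp (Φ.DbandChart x) := by
  have : (fun y ↦ ((Φ.band y : 𝕊 3) : 𝔼 4)) = phi ∘ Φ.bandChart := rfl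
  rw [this, fderiv_comp x ((contDiff_phi.differentiable (by simp)) _)
    (Φ.hasFDerivAt_bandChart x).differentiableAt, fderiv_bandChart]

/-- **The band is an immersion on the collar strip.** [folklore] -/
theorem injective_mfderiv_band {x : 𝔼 2} (hx : x 1 ∈ Ioo (-1 : ℝ) 2) :
    Injective (mfderiv 𝓘(ℝ, 𝔼 2) (𝓡 3) Φ.band x) := by
  refine injective_mfderiv_of_injective_fderiv_coe Φ.contMDiff_band ?_
  rw [Φ.fderiv_coe_band, ContinuousLinearMap.coe_comp]
  exact (injective_fderiv_phi _).comp (Φ.injective_DbandChart hx)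

/-- The last coordinate of the band point is positive iff `x₀ < 1/2` (northern half). [folklore] -/
theorem band_apply_last_pos_iff {x : 𝔼 2} (hx : x 1 ∈ Ioo (-1 : ℝ) 2) :
    0 < ((Φ.band x : 𝕊 3) : 𝔼 4) (Fin.last 3) ↔ x 0 < 2⁻¹ := by
  rw [show (Fin.last 3 : Fin 4) = 3 from rfl, coe_band, phi_apply_three_pos_iff,
    Φ.norm_bandChart_lt_two_iff hx]

/-- The last coordinate of the band point is negative iff `1/2 < x₀` (southern half). [folklore] -/
theorem band_apply_last_neg_iff {x : 𝔼 2} (hx : x 1 ∈ Ioo (-1 : ℝ) 2) :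
    ((Φ.band x : 𝕊 3) : 𝔼 4) (Fin.last 3) < 0 ↔ 2⁻¹ < x 0 := by
  rw [show (Fin.last 3 : Fin 4) = 3 from rfl, coe_band, phi_apply_three_neg_iff,
    Φ.two_lt_norm_bandChart_iff hx]

/-- **The band meets the equator exactly in its middle line** `x₀ = 1/2`. [folklore] -/
theorem band_mem_sphereEquator_iff {x : 𝔼 2} (hx : x 1 ∈ Ioo (-1 : ℝ) 2) :
    Φ.band x ∈ sphereEquator 2 ↔ x 0 = 2⁻¹ := by
  rw [mem_sphereEquator_iff, show (Fin.last 3 : Fin 4) = 3 from rfl, coe_band,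
    phi_apply_three_eq_zero_iff, Φ.norm_bandChart_eq_two_iff hx]

/-- **The left edge line runs along `A`**: `band (0, x₁) = A (θaff x₁)` on the collar. [folklore] -/
theorem band_pt2_zero {x₁ : ℝ} (hx : x₁ ∈ Ioo (-1 : ℝ) 2) :
    Φ.band (pt2 0 x₁) = Φ.A (circlePoint (Φ.θaff x₁)) := by
  rw [band, bandChart_pt2_zero, segPt, S, ← Φ.seg _ (Φ.θaff_mem_Icc hx),
    psi_symm_apply_psi (Φ.ne_southPole _)]

/-- The left edge line read in `ℝ⁴` is the curve of `A`. [folklore] -/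
theorem coe_band_pt2_zero {x₁ : ℝ} (hx : x₁ ∈ Ioo (-1 : ℝ) 2) :
    ((Φ.band (pt2 0 x₁) : 𝕊 3) : 𝔼 4) = SphereEmbedding.curve Φ.A (Φ.θaff x₁) := by
  rw [Φ.band_pt2_zero hx, SphereEmbedding.curve_apply]

/-- The right edge line read in `ℝ⁴` is the reflected left edge line. [folklore] -/
theorem coe_band_pt2_one (x₁ : ℝ) :
    ((Φ.band (pt2 1 x₁) : 𝕊 3) : 𝔼 4) = refl4 (Φ.band (pt2 0 x₁)) := by
  rw [← coe_band_sflip, sflip_pt2, sub_zero]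

/-! ## The reversed mirror image `B = -Ā` of `A` -/

/-- The reflection of the circle in coordinates of the angle: `(cos θ, -sin θ) = circlePoint (-θ)`
(through `circleConj_circlePoint` of `CircleDiffeotopy.lean`; the same statement is
`reflectLast_circlePoint` of `KirbyMovesReverseProofs.lean`, whose import chain — Kirby moves and
surgery — is avoided here). [folklore] -/
theorem reflectLast_one_circlePoint (θ : ℝ) : reflectLast 1 (circlePoint θ) = circlePoint (-θ) := by
  rw [← coe_circleConj_eq_reflectLast, circleConj_circlePoint]

/-- The reversed mirror image along the angle: `(-Ā) (circlePoint θ) = R (A (circlePoint (-θ)))`.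
[folklore] -/
theorem mirror_reverse_apply_circlePoint (K : Knot) (θ : ℝ) :
    K.mirror.reverse (circlePoint θ) = reflectLast 3 (K (circlePoint (-θ))) := by
  change reflectLast 3 (K (reflectLast 1 (circlePoint θ))) = _
  rw [reflectLast_one_circlePoint]

/-- The curve of the reversed mirror image: `(-Ā).curve θ = R (A.curve (-θ))`. [folklore] -/
theorem curve_mirror_reverse (K : Knot) (θ : ℝ) :
    SphereEmbedding.curve K.mirror.reverse θ = refl4 (SphereEmbedding.curve K (-θ)) := by
  rw [SphereEmbedding.curve_apply, mirror_reverse_apply_circlePoint, coe_reflectLast_three_eq,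
    SphereEmbedding.curve_apply]

/-- The range of the reversed mirror image is the reflected range. [folklore] -/
theorem range_mirror_reverse (K : Knot) : range K.mirror.reverse = reflectLast 3 '' range K := by
  ext y
  constructor
  · rintro ⟨z, rfl⟩
    obtain ⟨θ, rfl⟩ := circlePoint_surjective z
    rw [mirror_reverse_apply_circlePoint]
    exact ⟨_, ⟨_, rfl⟩, rfl⟩
  · rintro ⟨-, ⟨z, rfl⟩, rfl⟩
    obtain ⟨θ, rfl⟩ := circlePoint_surjective z
    refine ⟨circlePoint (-θ), ?_⟩
    rw [mirror_reverse_apply_circlePoint, neg_neg]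

/-- **The right edge line runs along `B = -Ā`**: `band (1, x₁) = B (-θaff x₁)` on the collar.
[folklore] -/
theorem band_pt2_one {x₁ : ℝ} (hx : x₁ ∈ Ioo (-1 : ℝ) 2) :
    Φ.band (pt2 1 x₁) = Φ.A.mirror.reverse (circlePoint (-Φ.θaff x₁)) := by
  rw [mirror_reverse_apply_circlePoint, neg_neg, ← Φ.band_pt2_zero hx, ← band_sflip, sflip_pt2,
    sub_zero]

/-! ## The band meets `A` exactly in its left edge line and `B` in its right edge line -/

/-- **The band meets `A` exactly in its left edge line** (on the collar square of any width
`δ ≤ ν/2`, `δ ≤ 1`): below the segment the band points lie at height `< -1`, hence off `A`;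
slightly above it (`x₀ < 0`) they lie in the slab met by `A` only along the segment, but not on
the segment. [folklore] -/
theorem band_mem_range_A_iff {δ : ℝ} (hδ : δ ≤ Φ.ν / 2) (hδ1 : δ ≤ 1) {x : 𝔼 2}
    (hx : x ∈ squareNhd δ) : Φ.band x ∈ range Φ.A ↔ x 0 = 0 := by
  have hx0 := hx 0
  have hx1 := hx 1
  have hx1' : x 1 ∈ Ioo (-1 : ℝ) 2 := ⟨by linarith [hx1.1], by linarith [hx1.2]⟩
  constructor
  · rintro ⟨z, hz⟩
    have hpsi : psi (Φ.A z) = Φ.bandChart x := by rw [hz, psi_band]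
    -- the height of the band point is `-μ ≥ -1`, so `μ ≤ 1`, i.e. `x₀ ≤ 0`
    have hh := Φ.height z
    rw [hpsi, bandChart_apply_two] at hh
    have hμle : Φ.μb x ≤ 1 := by linarith
    have hL := Φ.L_pos hx1'
    have hx0le : x 0 ≤ 0 := by
      by_contra h
      push Not at h
      have : 1 < Φ.μb x := by
        rw [μb]; exact Real.one_lt_exp_iff.2 (by positivity)
      linarith
    -- in the slab: `|⟪·, e⟫| = μ |S| < ℓ` and height `-μ < -1 + ν`
    have hslab1 : |⟪psi (Φ.A z) - qbase, Φ.e⟫| < Φ.ℓ := by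
      rw [hpsi, inner_sub_left, inner_bandChart_e, Φ.inner_qbase_e, sub_zero, abs_mul,
        abs_of_pos (Φ.μb_pos x)]
      calc Φ.μb x * |Φ.S (x 1)| ≤ 1 * |Φ.S (x 1)| := by gcongr
        _ < Φ.ℓ := by rw [one_mul]; exact Φ.abs_S_lt hx1'
    have hslab2 : psi (Φ.A z) 2 < -1 + Φ.ν := by
      rw [hpsi, bandChart_apply_two]
      -- `μ = e^{2 x₀ L} ≥ 1 + 2 x₀ L > 1 - ν`
      have h1 : 1 + 2 * x 0 * Φ.L (x 1) ≤ Φ.μb x := by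
        rw [μb]; linarith [Real.add_one_le_exp (2 * x 0 * Φ.L (x 1))]
      have h2 : -Φ.ν < 2 * x 0 * Φ.L (x 1) := by
        have hL1 := Φ.L_lt_one (x 1)
        nlinarith [hx0.1, Φ.ν_pos]
      linarith
    obtain ⟨s, -, hs⟩ := Φ.box z hslab1 hslab2
    -- on the segment the height is `-1`, so `μ = 1`, so `x₀ = 0`
    have h2 := congrArg (fun y : 𝔼 3 ↦ y 2) hs
    simp only [hpsi, bandChart_apply_two, PiLp.add_apply, PiLp.smul_apply, smul_eq_mul, Φ.e_two,
      mul_zero, add_zero, qbase_apply] at h2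
    have hμ1 : Φ.μb x = 1 := by simpa using h2
    rw [μb, Real.exp_eq_one_iff] at hμ1
    rcases mul_eq_zero.1 hμ1 with h | h
    · linarith
    · exact absurd h hL.ne'
  · intro h0
    rw [← BandSumUnit.pt2_eta x, h0, Φ.band_pt2_zero hx1']
    exact ⟨_, rfl⟩

/-- **The band meets `B = -Ā` exactly in its right edge line** (by the symmetry `band_sflip`).
[folklore] -/
theorem band_mem_range_B_iff {δ : ℝ} (hδ : δ ≤ Φ.ν / 2) (hδ1 : δ ≤ 1) {x : 𝔼 2}
    (hx : x ∈ squareNhd δ) : Φ.band x ∈ range Φ.A.mirror.reverse ↔ x 0 = 1 := by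
  rw [range_mirror_reverse, ← sflip_sflip x, band_sflip,
    (involutive_reflectLast 3).injective.mem_set_image, Φ.band_mem_range_A_iff hδ hδ1 (sflip_mem_squareNhd hx),
    sflip_apply_zero, sflip_sflip]
  constructor <;> intro h <;> linarith

/-! ## Velocities along the edge lines; the orientation clauses of the band -/

/-- `1/2 ∈ (-1, 2)`. [folklore] -/
theorem half_mem_Ioo : (2⁻¹ : ℝ) ∈ Ioo (-1 : ℝ) 2 := by norm_num

/-- **The velocity of the band along its left edge line** is `κ` times the velocity of `A`.
[folklore] -/
theorem hasDerivAt_coe_band_left {x₁ : ℝ} (hx : x₁ ∈ Ioo (-1 : ℝ) 2) :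
    HasDerivAt (fun t ↦ ((Φ.band (pt2 0 t) : 𝕊 3) : 𝔼 4))
      (Φ.κ • SphereEmbedding.tangent Φ.A (Φ.θaff x₁)) x₁ := by
  have h := (SphereEmbedding.hasDerivAt_curve Φ.A (Φ.θaff x₁)).scomp x₁ (Φ.hasDerivAt_θaff x₁)
  refine h.congr_of_eventuallyEq ?_
  filter_upwards [Ioo_mem_nhds hx.1 hx.2] with t ht
  exact Φ.coe_band_pt2_zero ht

/-- The velocity of the band along its right edge line is the reflected one. [folklore] -/
theorem hasDerivAt_coe_band_right {x₁ : ℝ} (hx : x₁ ∈ Ioo (-1 : ℝ) 2) :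
    HasDerivAt (fun t ↦ ((Φ.band (pt2 1 t) : 𝕊 3) : 𝔼 4))
      (refl4 (Φ.κ • SphereEmbedding.tangent Φ.A (Φ.θaff x₁))) x₁ := by
  have h := refl4.hasFDerivAt.comp_hasDerivAt x₁ (Φ.hasDerivAt_coe_band_left hx)
  refine h.congr_of_eventuallyEq (Filter.Eventually.of_forall fun t ↦ ?_)
  exact Φ.coe_band_pt2_one t

/-- The band read in `ℝ⁴` is differentiable. [folklore] -/
theorem differentiable_coe_band : Differentiable ℝ fun x ↦ ((Φ.band x : 𝕊 3) : 𝔼 4) :=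
  Φ.contDiff_coe_band.differentiable (by simp)

/-- The partial derivative of the band along `x₁` on the left edge line. [folklore] -/
theorem fderiv_coe_band_pt2_zero {x₁ : ℝ} (hx : x₁ ∈ Ioo (-1 : ℝ) 2) :
    fderiv ℝ (fun x ↦ ((Φ.band x : 𝕊 3) : 𝔼 4)) (pt2 0 x₁) (pt2 0 1) =
      Φ.κ • SphereEmbedding.tangent Φ.A (Φ.θaff x₁) := by
  have h1 := (Φ.differentiable_coe_band (pt2 0 x₁)).hasFDerivAt.comp_hasDerivAt x₁
    (by simpa using hasDerivAt_pt2 (hasDerivAt_const x₁ (0 : ℝ)) (hasDerivAt_id x₁) :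
      HasDerivAt (fun t : ℝ ↦ pt2 0 t) (pt2 0 1) x₁)
  exact h1.unique (Φ.hasDerivAt_coe_band_left hx)

/-- The partial derivative of the band along `x₁` on the right edge line. [folklore] -/
theorem fderiv_coe_band_pt2_one {x₁ : ℝ} (hx : x₁ ∈ Ioo (-1 : ℝ) 2) :
    fderiv ℝ (fun x ↦ ((Φ.band x : 𝕊 3) : 𝔼 4)) (pt2 1 x₁) (pt2 0 1) =
      refl4 (Φ.κ • SphereEmbedding.tangent Φ.A (Φ.θaff x₁)) := by
  have h1 := (Φ.differentiable_coe_band (pt2 1 x₁)).hasFDerivAt.comp_hasDerivAt x₁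
    (by simpa using hasDerivAt_pt2 (hasDerivAt_const x₁ (1 : ℝ)) (hasDerivAt_id x₁) :
      HasDerivAt (fun t : ℝ ↦ pt2 1 t) (pt2 0 1) x₁)
  exact h1.unique (Φ.hasDerivAt_coe_band_right hx)

/-- **Orientation of `A` along the left edge: upwards** (the clause `orient_left` of `BandData`
for the radial band, at the parameter `θ₁` with factor `1/κ`). [folklore] -/
theorem orient_left_band : ∃ θ c : ℝ, 0 < c ∧ Φ.A (circlePoint θ) = Φ.band (pt2 0 2⁻¹) ∧
    deriv (fun t ↦ ((Φ.A (circlePoint t) : 𝕊 3) : 𝔼 4)) θ =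
      c • fderiv ℝ (fun x ↦ ((Φ.band x : 𝕊 3) : 𝔼 4)) (pt2 0 2⁻¹) (pt2 0 1) := by
  refine ⟨Φ.θ₁, Φ.κ⁻¹, inv_pos.2 Φ.κ_pos, ?_, ?_⟩
  · rw [Φ.band_pt2_zero half_mem_Ioo, θaff_half]
  · rw [Φ.fderiv_coe_band_pt2_zero half_mem_Ioo, θaff_half, smul_smul,
      inv_mul_cancel₀ Φ.κ_pos.ne', one_smul]
    exact (SphereEmbedding.hasDerivAt_curve Φ.A Φ.θ₁).deriv

/-- The velocity of `B = -Ā`: `(B.curve)' (θ) = -R (A.curve' (-θ))`. [folklore] -/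
theorem hasDerivAt_curve_mirror_reverse (K : Knot) (θ : ℝ) :
    HasDerivAt (SphereEmbedding.curve K.mirror.reverse)
      (-refl4 (SphereEmbedding.tangent K (-θ))) θ := by
  have h1 : HasDerivAt (fun t ↦ SphereEmbedding.curve K (-t))
      ((-1 : ℝ) • SphereEmbedding.tangent K (-θ)) θ :=
    (SphereEmbedding.hasDerivAt_curve K (-θ)).scomp θ (hasDerivAt_neg θ)
  have h2 := refl4.hasFDerivAt.comp_hasDerivAt θ h1
  rw [map_smul, neg_one_smul] at h2
  refine h2.congr_of_eventuallyEq (Filter.Eventually.of_forall fun t ↦ ?_)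
  exact curve_mirror_reverse K t

/-- **Orientation of `B = -Ā` along the right edge: downwards** (the clause `orient_right` of
`BandData` for the radial band, at the parameter `-θ₁` with factor `1/κ`). [folklore] -/
theorem orient_right_band : ∃ θ c : ℝ, 0 < c ∧
    Φ.A.mirror.reverse (circlePoint θ) = Φ.band (pt2 1 2⁻¹) ∧
    deriv (fun t ↦ ((Φ.A.mirror.reverse (circlePoint t) : 𝕊 3) : 𝔼 4)) θ =
      c • fderiv ℝ (fun x ↦ ((Φ.band x : 𝕊 3) : 𝔼 4)) (pt2 1 2⁻¹) (pt2 0 (-1)) := by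
  refine ⟨-Φ.θ₁, Φ.κ⁻¹, inv_pos.2 Φ.κ_pos, ?_, ?_⟩
  · rw [Φ.band_pt2_one half_mem_Ioo, θaff_half]
  · have hneg : pt2 (0 : ℝ) (-1) = -pt2 0 1 := by
      ext i; fin_cases i <;> simp
    rw [hneg, map_neg, Φ.fderiv_coe_band_pt2_one half_mem_Ioo, θaff_half, map_smul, smul_neg,
      smul_smul, inv_mul_cancel₀ Φ.κ_pos.ne', one_smul]
    have h := (hasDerivAt_curve_mirror_reverse Φ.A (-Φ.θ₁)).deriv
    rw [neg_neg] at h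
    exact h

end FlatModel

end FoxMilnorModel

end Literature.Topology.FourManifolds
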